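import Summits.BirchSwinnertonDyer.Rank1Residual.X11b.NoTorsionOfIrreducible
import Summits.BirchSwinnertonDyer.Rank1Residual.X11b.InertiaTransport
import Summits.BirchSwinnertonDyer.Rank1Residual.X11b.RingClassFieldNoTorsion
import Literature.NumberTheory.EllipticCurves.HeegnerPointsKolyvaginConjugation
import Literature.NumberTheory.EllipticCurves.RingClassFieldSplitting
import HarnessLib

/-!
# `E(K[m])[p] = 0` and the `hA` binder from IRREDUCIBILITY of `E[p]` (`p` unramified in `K`, `p ∤ m`)
# — Gross 1991, Lemma 4.3 without surjectivity, instantiated at ring class fields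

Cell `b2b-bsdres`, team x11b3 (N8/O2), `h44` programme — (P4-C) FILE 2b of x11b3-p4 GEN 6 (the
instantiation of FILE 1 `X11b/NoTorsionOfIrreducible.lean` at `L = K[m]`, with the generic Galois
glue of FILE 2a `X11b/InertiaTransport.lean`).  Summit-side THEOREM-ONLY file (no definition, no named
fact, no `sorry`); `K : Type`; nothing is `p = 3`-specific (`p` odd).

HONEST FRAMING (binding): **plumbing — the `hA` binder (admissibility of `E(K[m]) ⊆ E(K̄)` modulo
`p^M`; McCallum 1991 §4 (5), Gross 1991 Lemma 4.3) on the IRREDUCIBLE-NON-SURJECTIVE cell**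
(`ClassRecordAtThree`: `¬ Surj W 3 ∧ 3 ∣ v₃(Δ) ∧ ¬ Ram W 3`), the COMPLEMENT of x11b3-p3's
`RingClassFieldNoTorsion.isAdmissible_pointsSubgroup` (which needs `Surj W p`): here the inputs are
`W.HasIrreducibleModPGaloisRep p`, the Weil pairing (`W.exists_weilPairing p`, the tree's named fact,
a binder as everywhere in the `h44` chain), `p` odd, `p` UNRAMIFIED in the quadratic field `K`, and
`p ∤ m`.  At `3 ∣ N` + Heegner, `3` splits in `K` and Kolyvagin primes are `≠ 3`, so the side
conditions hold on ALL of X11b@3.  ONE HOME for THIS supply (p3's surjective home untouched);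
consumers keep or replace their `hA` binder by name.  `h44` / (γ) are NOT discharged; `h37` stays
bypassed for concrete data; the class record / (t) / node are unchanged; nothing is booked; no mark /
label / count / tier moves.

## The argument (FILE 1's ENGINE, instantiated)

In `Γ_ℚ` (read inside `Aut_ℚ(L̄)` through the tree's `absGaloisTransport`, x11b3-p3's pattern):
`A = {g : g|_K = 1}` (index `2`, a kernel, hence normal; `Γ_ℚ = A ∪ cA`, `c² ∈ A` by Mathlib
`Subgroup.mul_mem_iff_of_index_two`); `N = {g : e g e⁻¹ fixes L ⊆ L̄}` = the image of `Γ_L`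
(`mem_range_absGaloisRestrict_iff`), normalised by `A` because `L/K` is NORMAL; `τ` = the
restriction to `Γ_ℚ` of a LOCAL inertia element at `p` with non-trivial mod-`p` cyclotomic character
(`Rat.exists_mem_absInertia_adicCompletion_modPCyclotomicCharacterZMod_eq`, Serre *Local Fields* IV §4;
`resGalOfEmb_mem_inertia_primeBelow`, Neukirch II (9.6)) — it moves a primitive `p`-th root of unity,
hence (Weil pairing, `det_eq_modPCyclotomicCharacterZMod_of_exists_weilPairing`) moves a point of
`E[p]`; and EVERY `Γ_ℚ`-conjugate of `τ` lies in `N`, because every inertia group of `Γ_ℚ` above `p`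
fixes `K` (`K/ℚ` normal, unramified at `p`) and then `L` (`L/K` normal, unramified above `p`) — FILE
2a's `smul_eq_of_mem_inertia_of_isUnramifiedIn'` twice, after transporting the inertia group into
`Aut_ℚ(L̄)` (`exists_prime_forall_absGaloisTransport_mem_inertia`) and re-basing it over `𝓞 K`
(`exists_prime_over_forall_mem_inertia_of_restrictScalars`).  FILE 1's
`torsionBy_eq_bot_of_hasIrreducibleModPGaloisRep_of_biFixed_type` then gives `E(L)[p] = 0`.

## What is proved

* `NoTorsionIrr.exists_biFixedData_of_isGalois` — FILE 1's group data `(A, N, c, τ)` for `K` quadratic,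
  `L/K` finite Galois, `p` odd unramified in `K` and (above `p`) in `L`.
* **`NoTorsionIrr.torsionBy_eq_bot_of_isGalois_of_hasIrreducibleModPGaloisRep`** — `E(L)[p] = 0` for
  such `L` from `(irr)` + Weil pairing.
* **`NoTorsionIrr.torsionBy_ringClassField_eq_bot_of_hasIrreducibleModPGaloisRep`**, `…_pow_…` —
  `E(K[m])[p] = 0`, `E(K[m])[p^M] = 0` (`K` imaginary quadratic, `m ≠ 0`, `p ∤ m`, `p` unramified in `K`).
* **`NoTorsionIrr.isAdmissible_pointsSubgroup_of_hasIrreducibleModPGaloisRep`** (+ `_of_dvd` family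
  form) — the `hA` binder text of the concrete `h44` chain, on the irreducible cell.

## References

* [GrossLMS1991] B. H. Gross, *Kolyvagin's work on modular elliptic curves*, LMS LNS 153 (1991), §4,
  Lemma 4.3 (surjective case; held `book:editornd-l-functions-arithmetic`, PDF p. 219).
* [McCallumLMS1991] W. G. McCallum, ibid., §4 (5). [SerreLocalFields1979] Serre, *Local Fields*, IV §4.
* [NeukirchANT1999] J. Neukirch, *Algebraic Number Theory*, Ch. I §9, Ch. II (9.6).
* [Cox2013] D. A. Cox, *Primes of the form x² + ny²*, 2nd ed., §9.A (`K[m]/K` Galois, unramified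
  outside `m`).

## Mathlib / tree search

Tree: FILE 1 `NoTorsionIrr.*`, FILE 2a `InertiaTransport.*`, x11b3-p3 `RingClassNoTorsion.smul_toGeomPoints_eq`,
`absGaloisTransport`, `mem_range_absGaloisRestrict_iff`, `modPCyclotomicCharacterZMod_spec`,
`det_eq_modPCyclotomicCharacterZMod_of_exists_weilPairing`, `KolyvaginImage.nonempty_addEquiv_of_card_eq_sq`,
`card_torsionPoints_eq_sq_holds`, `isUnramifiedIn_ringClassField`, `finiteDimensional_and_isGalois_ringClassField`.
Mathlib: `AlgEquiv.restrictNormalHom(_surjective)`, `AlgEquiv.restrictNormal_commutes`, `Subgroup.index_ker`,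
`Subgroup.mul_mem_iff_of_index_two`, `IsGalois.card_aut_eq_finrank`.
`lean search 'RingClassFieldNoTorsionOfIrreducible|biFixedData|of_isGalois_of_hasIrreducibleModPGaloisRep'` → none.
-/

noncomputable section

open scoped Classical Pointwise

namespace Summit.BirchSwinnertonDyer.Rank1Residual.X11b.NoTorsionIrr

open Field WeierstrassCurve NumberField IsDedekindDomain
open Literature.NumberTheory.EllipticCurves Literature.NumberTheory.GaloisRepresentations
open Rat.HeightOneSpectrum

/-! ## §1 FILE 1's group data for a Galois extension of a quadratic field, unramified above `p` -/

/-- **Group data `(A, N, c, τ)` of `NoTorsionIrr.smul_eq_self_of_irreducible_of_biFixed` for `K`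
quadratic and `L/K` finite Galois, at an odd prime `p` unramified in `K` and (above `p`) in `L`.**
Inside `Γ_ℚ` (transported to `Aut_ℚ(L̄)` by `absGaloisTransport`): `A = {g : g|_K = 1}` (index `2`,
normal; `Γ_ℚ = A ∪ cA`, `c² ∈ A`), `N = {g : e g e⁻¹|_L = 1}` (the image of `Γ_L`, normalised by `A`
as `L/K` is normal), and `τ ∈ Γ_ℚ` an inertia element above `p` moving a `p`-th root of unity
(FILE 2a `InertiaTransport.exists_mem_inertia_smul_ne`) all of whose conjugates lie in `N` (every inertia group above `p` fixes
`K`, then `L`: FILE 2a).  [cite: NeukirchANT1999, Ch. I §9 (9.4), (9.6)]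
[cite: GrossLMS1991, §4, proof of Lemma 4.3] -/
theorem exists_biFixedData_of_isGalois (K : Type) [Field K] [NumberField K]
    (hK2 : Module.finrank ℚ K = 2) (L : Type) [Field L] [NumberField L] [Algebra K L] [IsGalois K L]
    {p : ℕ} (hp : p.Prime) (hp2 : p ≠ 2)
    (hKunr : ∀ v : HeightOneSpectrum (𝓞 ℚ), (p : 𝓞 ℚ) ∈ v.asIdeal →
      Algebra.IsUnramifiedIn (𝓞 K) v.asIdeal)
    (hLunr : ∀ w : HeightOneSpectrum (𝓞 K), (p : 𝓞 K) ∈ w.asIdeal →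
      Algebra.IsUnramifiedIn (𝓞 L) w.asIdeal) :
    ∃ (A N : Subgroup (absoluteGaloisGroup ℚ)) (c τ : absoluteGaloisGroup ℚ) (ζ : AlgebraicClosure ℚ),
      (∀ g : absoluteGaloisGroup ℚ, g ∈ A ∨ c⁻¹ * g ∈ A) ∧
      (∀ g : absoluteGaloisGroup ℚ, ∀ a ∈ A, g * a * g⁻¹ ∈ A) ∧ c * c ∈ A ∧
      (∀ a ∈ A, ∀ n ∈ N, a * n * a⁻¹ ∈ N) ∧
      (∀ n ∈ N, ∃ t : absoluteGaloisGroup L, resGal (K := ℚ) L t = n) ∧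
      (∀ g : absoluteGaloisGroup ℚ, g⁻¹ * τ * g ∈ N) ∧ ζ ^ p = 1 ∧ τ • ζ ≠ ζ := by
  -- ### the fields `ℚ ⊂ K ⊂ L ⊂ L̄`
  haveI : Algebra.IsQuadraticExtension ℚ K := ⟨hK2⟩
  haveI : FiniteDimensional K L := Module.Finite.of_restrictScalars_finite ℚ K L
  haveI : IsScalarTower ℚ K L := IsScalarTower.of_algebraMap_eq' (RingHom.ext_rat _ _).symm
  haveI : IsScalarTower ℚ K (AlgebraicClosure L) :=
    IsScalarTower.of_algebraMap_eq' (RingHom.ext_rat _ _).symm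
  haveI : Algebra.IsAlgebraic ℚ (AlgebraicClosure L) := Algebra.IsAlgebraic.trans ℚ L _
  haveI : Normal ℚ (AlgebraicClosure L) := (IsAlgClosure.mk inferInstance inferInstance :
    IsAlgClosure ℚ (AlgebraicClosure L)).normal
  -- ### transport `Γ_ℚ ≃ Aut_ℚ(L̄)` and the restriction to `K`
  let Φ : absoluteGaloisGroup ℚ ≃* (AlgebraicClosure L ≃ₐ[ℚ] AlgebraicClosure L) :=
    absGaloisTransport (K := ℚ) (L := L)
  let rK : (AlgebraicClosure L ≃ₐ[ℚ] AlgebraicClosure L) →* (K ≃ₐ[ℚ] K) :=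
    AlgEquiv.restrictNormalHom K
  -- ### `A = {g : Φ g fixes K}`
  let A : Subgroup (absoluteGaloisGroup ℚ) := rK.ker.comap Φ.toMonoidHom
  haveI hAn : A.Normal := inferInstance
  have hfixK : ∀ a ∈ A, ∀ k : K,
      Φ a (algebraMap K (AlgebraicClosure L) k) = algebraMap K (AlgebraicClosure L) k := by
    intro a ha k
    have h1 : rK (Φ a) = 1 := ha
    have h2 := AlgEquiv.restrictNormal_commutes (Φ a) K k
    change algebraMap K (AlgebraicClosure L) (rK (Φ a) k) = _ at h2
    rw [h1, AlgEquiv.one_apply] at h2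
    exact h2.symm
  have hmemA : ∀ g : absoluteGaloisGroup ℚ,
      (∀ k : K, Φ g (algebraMap K (AlgebraicClosure L) k) = algebraMap K (AlgebraicClosure L) k) →
        g ∈ A := by
    intro g hg
    change rK (Φ g) = 1
    refine AlgEquiv.ext fun k ↦ ?_
    apply (algebraMap K (AlgebraicClosure L)).injective
    have h2 := AlgEquiv.restrictNormal_commutes (Φ g) K k
    change algebraMap K (AlgebraicClosure L) (rK (Φ g) k) = _ at h2
    rw [h2, AlgEquiv.one_apply]
    exact hg k
  -- `A` has index `2`
  have hA2 : A.index = 2 := by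
    have hsurj : Function.Surjective (rK.comp Φ.toMonoidHom) :=
      (AlgEquiv.restrictNormalHom_surjective (F := ℚ) (K₁ := K) (E := AlgebraicClosure L)).comp
        Φ.surjective
    have hker : A = (rK.comp Φ.toMonoidHom).ker := rfl
    rw [hker, Subgroup.index_ker, MonoidHom.range_eq_top.mpr hsurj, Subgroup.card_top]
    exact (IsGalois.card_aut_eq_finrank ℚ K).trans hK2
  -- some `c ∉ A`
  obtain ⟨c, hc⟩ : ∃ c : absoluteGaloisGroup ℚ, c ∉ A := by
    by_contra h
    have : A = ⊤ := top_unique fun g _ ↦ not_not.mp (not_exists.mp h g)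
    rw [this, Subgroup.index_top] at hA2
    exact absurd hA2 (by norm_num)
  -- the `K`-linear upgrade of an element of `A`
  let up : ∀ a ∈ A, AlgebraicClosure L ≃ₐ[K] AlgebraicClosure L := fun a ha ↦
    { (Φ a : AlgebraicClosure L ≃ₐ[ℚ] AlgebraicClosure L) with commutes' := hfixK a ha }
  have hup : ∀ a (ha : a ∈ A) (y : AlgebraicClosure L), up a ha y = Φ a y := fun _ _ _ ↦ rfl
  -- an element of `A` maps `L ⊆ L̄` into itself (`L/K` normal)
  have hAL : ∀ a (ha : a ∈ A) (x : L), ∃ x' : L,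
      Φ a (algebraMap L (AlgebraicClosure L) x) = algebraMap L (AlgebraicClosure L) x' := by
    intro a ha x
    refine ⟨AlgEquiv.restrictNormal (up a ha) L x, ?_⟩
    rw [← hup a ha]
    exact (AlgEquiv.restrictNormal_commutes (up a ha) L x).symm
  -- ### `N = {g : Φ g fixes L}`
  let L' : IntermediateField ℚ (AlgebraicClosure L) :=
    (IsScalarTower.toAlgHom ℚ L (AlgebraicClosure L)).fieldRange
  let N : Subgroup (absoluteGaloisGroup ℚ) := L'.fixingSubgroup.comap Φ.toMonoidHom
  have hmemN : ∀ g : absoluteGaloisGroup ℚ, g ∈ N ↔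
      ∀ x : L, Φ g (algebraMap L (AlgebraicClosure L) x) = algebraMap L (AlgebraicClosure L) x := by
    intro g
    change Φ g ∈ L'.fixingSubgroup ↔ _
    rw [IntermediateField.mem_fixingSubgroup_iff]
    constructor
    · intro h x
      exact h _ ⟨x, rfl⟩
    · rintro h _ ⟨x, rfl⟩
      exact h x
  -- ### the inertia element `τ`
  obtain ⟨v, 𝔓, τ, ζ, hpv, h𝔓, hτI, hζp, hτζ⟩ := InertiaTransport.exists_mem_inertia_smul_ne hp hp2
  -- every inertia group of `Γ_ℚ` above `p` lies in `N`
  have hIN : ∀ (𝔔 : Ideal (absIntegers (𝓞 ℚ) ℚ)), 𝔔 ∈ v.primesAbove →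
      ∀ i ∈ 𝔔.inertia (absoluteGaloisGroup ℚ), i ∈ N := by
    intro 𝔔 h𝔔 i hi
    -- transport to `Aut_ℚ(L̄)`
    obtain ⟨𝔔', h𝔔'p, h𝔔'o, htr⟩ :=
      InertiaTransport.exists_prime_forall_absGaloisTransport_mem_inertia (K := ℚ) L h𝔔
    have hi' := htr i hi
    -- Step 1: `K/ℚ` normal, unramified at `p` ⇒ `Φ i` fixes `K`, i.e. `i ∈ A`
    have hiA : i ∈ A := hmemA i fun k ↦
      InertiaTransport.smul_eq_of_mem_inertia_of_isUnramifiedIn' K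
        (IsScalarTower.toAlgHom ℚ K (AlgebraicClosure L)) (hKunr v hpv) h𝔔'p h𝔔'o hi' k
    -- Step 2: re-base over `𝓞 K`; `L/K` normal, unramified above `p` ⇒ `up i` fixes `L`
    obtain ⟨𝔔₂, w, h𝔔₂p, h𝔔₂o, hwv, hreb⟩ :=
      InertiaTransport.exists_prime_over_forall_mem_inertia_of_restrictScalars (k₀ := ℚ) (k := K)
        (Ω := AlgebraicClosure L) h𝔔'p h𝔔'o
    have hpw : (p : 𝓞 K) ∈ w.asIdeal := by
      have h : (p : 𝓞 ℚ) ∈ w.asIdeal.under (𝓞 ℚ) := by rw [hwv]; exact hpv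
      rw [Ideal.under_def, Ideal.mem_comap, map_natCast] at h
      exact h
    have hupI : up i hiA ∈ 𝔔₂.inertia (AlgebraicClosure L ≃ₐ[K] AlgebraicClosure L) :=
      hreb (up i hiA) (Φ i) (fun y ↦ rfl) hi'
    rw [hmemN]
    intro x
    rw [← hup i hiA]
    exact InertiaTransport.smul_eq_of_mem_inertia_of_isUnramifiedIn' L
      (IsScalarTower.toAlgHom K L (AlgebraicClosure L)) (hLunr w hpw) h𝔔₂p h𝔔₂o hupI x
  refine ⟨A, N, c, τ, ζ, ?_, fun g a ha ↦ hAn.conj_mem a ha g, ?_, ?_, ?_, ?_, hζp, hτζ⟩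
  · -- `Γ_ℚ = A ∪ cA`
    intro g
    by_cases hg : g ∈ A
    · exact Or.inl hg
    · right
      rw [Subgroup.mul_mem_iff_of_index_two hA2]
      exact ⟨fun h ↦ absurd (A.inv_mem_iff.mp h) hc, fun h ↦ absurd h hg⟩
  · -- `c² ∈ A`
    rw [Subgroup.mul_mem_iff_of_index_two hA2]
  · -- `A` normalises `N`
    intro a ha n hn
    rw [hmemN] at hn ⊢
    intro x
    obtain ⟨x', hx'⟩ := hAL a⁻¹ (A.inv_mem ha) x
    rw [map_mul, map_mul, AlgEquiv.mul_apply, AlgEquiv.mul_apply, hx', hn x', ← hx', ← AlgEquiv.mul_apply,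
      ← map_mul, mul_inv_cancel, map_one, AlgEquiv.one_apply]
  · -- `N` lies in the image of `Γ_L`
    intro n hn
    obtain ⟨t, ht⟩ := (mem_range_absGaloisRestrict_iff (K := ℚ) (L := L) n).mpr ((hmemN n).mp hn)
    exact ⟨t, ht⟩
  · -- all conjugates of `τ` lie in `N`
    intro g
    have h := (Ideal.conj_mem_inertia_smul_iff 𝔓 g⁻¹ τ).mpr hτI
    rw [inv_inv] at h
    exact hIN _ (smul_mem_primesAbove h𝔓 g⁻¹) _ h


/-! ## §2 `E(L)[p] = 0` from irreducibility, and the ring class field -/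

/-- **`E(L)[p] = 0` from IRREDUCIBILITY of `E[p]`** for `K` quadratic, `L/K` finite Galois, `p` odd,
unramified in `K` and (above `p`) in `L`: FILE 1's
`torsionBy_eq_bot_of_hasIrreducibleModPGaloisRep_of_biFixed_type` fed with `exists_biFixedData_of_isGalois`;
the inertia element `τ` moves a point of `E[p]` because it moves a `p`-th root of unity (Weil pairing:
`det_eq_modPCyclotomicCharacterZMod_of_exists_weilPairing` in a frame `E[p] ≃ (ℤ/p)²` — trivial
action would give `χ̄_p(τ) = det 1 = 1`).  Gross 1991, Lemma 4.3 is the surjective case.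
[cite: GrossLMS1991, §4, Lemma 4.3] [cite: SilvermanAEC2009, III.8.1 (Weil pairing)] -/
theorem torsionBy_eq_bot_of_isGalois_of_hasIrreducibleModPGaloisRep (W : WeierstrassCurve ℚ)
    [W.IsElliptic] (K : Type) [Field K] [NumberField K] (hK2 : Module.finrank ℚ K = 2)
    (L : Type) [Field L] [NumberField L] [Algebra K L] [IsGalois K L] [DecidableEq L]
    {p : ℕ} (hp : p.Prime) (hp2 : p ≠ 2) (hirr : W.HasIrreducibleModPGaloisRep p)
    (hW : W.exists_weilPairing p)
    (hKunr : ∀ v : HeightOneSpectrum (𝓞 ℚ), (p : 𝓞 ℚ) ∈ v.asIdeal →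
      Algebra.IsUnramifiedIn (𝓞 K) v.asIdeal)
    (hLunr : ∀ w : HeightOneSpectrum (𝓞 K), (p : 𝓞 K) ∈ w.asIdeal →
      Algebra.IsUnramifiedIn (𝓞 L) w.asIdeal) :
    AddSubgroup.torsionBy (W.baseChange L).toAffine.Point (p : ℤ) = ⊥ := by
  -- reduce to the classical `DecidableEq` (the statement quantifies over it, as p3's twin does)
  obtain rfl : ‹DecidableEq L› = fun a b ↦ Classical.propDecidable (a = b) := Subsingleton.elim _ _
  haveI : Fact p.Prime := ⟨hp⟩
  obtain ⟨A, N, c, τ, ζ, hA, hAn, hc2, hNA, hN, hconj, hζp, hτζ⟩ :=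
    exists_biFixedData_of_isGalois K hK2 L hp hp2 hKunr hLunr
  -- `τ` moves a point of `E[p]` (Weil pairing)
  have hτE : ∃ P : geomTorsion W (p : ℤ), τ • P ≠ P := by
    by_contra h
    have h' : ∀ P : geomTorsion W (p : ℤ), τ • P = P := fun P ↦ by
      by_contra hP
      exact h ⟨P, hP⟩
    haveI : NeZero p := ⟨hp.ne_zero⟩
    have hT : ∀ P : geomTorsion W p, p • P = 0 := fun P ↦ by
      have := (mem_geomTorsion_iff W p _).mp P.2
      apply Subtype.ext
      rw [AddSubgroupClass.coe_nsmul, ← natCast_zsmul]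
      exact this
    have hcard : Nat.card (geomTorsion W p) = p ^ 2 :=
      card_torsionPoints_eq_sq_holds W (AlgebraicClosure ℚ) (by exact_mod_cast hp.ne_zero)
    obtain ⟨e⟩ := KolyvaginImage.nonempty_addEquiv_of_card_eq_sq hT hcard
    have hMv : ∀ P : geomTorsion W p, e (τ • P) = (1 : Matrix (Fin 2) (Fin 2) (ZMod p)).mulVec (e P) :=
      fun P ↦ by rw [h' P, Matrix.one_mulVec]
    have hdet := det_eq_modPCyclotomicCharacterZMod_of_exists_weilPairing W p hW e τ 1 hMv
    rw [Matrix.det_one] at hdet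
    have hspec := modPCyclotomicCharacterZMod_spec ℚ p τ ζ hζp
    rw [← hdet, ZMod.val_one] at hspec
    exact hτζ (by rw [hspec, pow_one])
  exact torsionBy_eq_bot_of_hasIrreducibleModPGaloisRep_of_biFixed_type L W hirr A N c hA hAn hc2
    hNA hN (by simpa using hconj 1) (hconj c) hτE

/-- For a prime `p ∤ m` and a place `w ∋ p` of `𝓞 K`: `m ∉ w` (Bézout `a p + b m = 1`).
[folklore] -/
theorem not_span_natCast_le_of_not_dvd (K : Type) [Field K] [NumberField K] {p m : ℕ}
    (hp : p.Prime) (hpm : ¬ p ∣ m) {w : HeightOneSpectrum (𝓞 K)} (hpw : (p : 𝓞 K) ∈ w.asIdeal) :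
    ¬ Ideal.span {((m : ℕ) : 𝓞 K)} ≤ w.asIdeal := by
  intro hle
  have hmw : (m : 𝓞 K) ∈ w.asIdeal := hle (Ideal.mem_span_singleton_self _)
  obtain ⟨a, b, hab⟩ := (Nat.Coprime.isCoprime ((Nat.Prime.coprime_iff_not_dvd hp).mpr hpm))
  apply w.isPrime.ne_top
  rw [Ideal.eq_top_iff_one]
  have h1 : (1 : 𝓞 K) = (a : 𝓞 K) * (p : 𝓞 K) + (b : 𝓞 K) * (m : 𝓞 K) := by
    have := congrArg (fun z : ℤ ↦ (z : 𝓞 K)) hab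
    push_cast at this
    exact this.symm
  rw [h1]
  exact w.asIdeal.add_mem (w.asIdeal.mul_mem_left _ hpw) (w.asIdeal.mul_mem_left _ hmw)

/-- **`E(K[m])[p] = 0` from IRREDUCIBILITY** (`K` imaginary quadratic, `ι : K → ℂ`, `m ≠ 0`, `p` odd
with `E[p]` irreducible and the Weil pairing, `p` unramified in `K`, `p ∤ m`) — Gross 1991,
Lemma 4.3 *"The curve `E` has no `K_n`-rational `p`-torsion"* on the irreducible-non-surjective cell:
`K[m]/K` is Galois (`finiteDimensional_and_isGalois_ringClassField`) and unramified at every place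
above `p` (`isUnramifiedIn_ringClassField`, Cox §9.A: `p ∤ m`).
[cite: GrossLMS1991, §4, Lemma 4.3] [cite: Cox2013, §9.A] -/
theorem torsionBy_ringClassField_eq_bot_of_hasIrreducibleModPGaloisRep (W : WeierstrassCurve ℚ)
    [W.IsElliptic] {K : Type} [Field K] [NumberField K] (hK : IsImaginaryQuadratic K) (ι : K →+* ℂ)
    {m : ℕ} (hm : m ≠ 0) {p : ℕ} (hp : p.Prime) (hp2 : p ≠ 2)
    (hirr : W.HasIrreducibleModPGaloisRep p) (hW : W.exists_weilPairing p)
    (hKunr : ∀ v : HeightOneSpectrum (𝓞 ℚ), (p : 𝓞 ℚ) ∈ v.asIdeal →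
      Algebra.IsUnramifiedIn (𝓞 K) v.asIdeal)
    (hpm : ¬ p ∣ m) :
    AddSubgroup.torsionBy (W.baseChange (ringClassField K ι m)).toAffine.Point (p : ℤ) = ⊥ := by
  haveI := (finiteDimensional_and_isGalois_ringClassField hK ι hm).1
  haveI := (finiteDimensional_and_isGalois_ringClassField hK ι hm).2
  haveI : NumberField (ringClassField K ι m) := NumberField.of_module_finite K _
  exact torsionBy_eq_bot_of_isGalois_of_hasIrreducibleModPGaloisRep W K hK.1 _ hp hp2 hirr hW hKunr
    fun w hpw ↦ isUnramifiedIn_ringClassField hK ι hm (not_span_natCast_le_of_not_dvd K hp hpm hpw)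

/-- **`E(K[m])[p^M] = 0` from irreducibility** (McCallum 1991, §4 (5): no `K_n`-rational `p`-torsion,
used for the uniqueness of `p^M`-division points). [cite: McCallumLMS1991, §4 (5)] -/
theorem torsionBy_pow_ringClassField_eq_bot_of_hasIrreducibleModPGaloisRep (W : WeierstrassCurve ℚ)
    [W.IsElliptic] {K : Type} [Field K] [NumberField K] (hK : IsImaginaryQuadratic K) (ι : K →+* ℂ)
    {m : ℕ} (hm : m ≠ 0) {p : ℕ} (hp : p.Prime) (hp2 : p ≠ 2)
    (hirr : W.HasIrreducibleModPGaloisRep p) (hW : W.exists_weilPairing p)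
    (hKunr : ∀ v : HeightOneSpectrum (𝓞 ℚ), (p : 𝓞 ℚ) ∈ v.asIdeal →
      Algebra.IsUnramifiedIn (𝓞 K) v.asIdeal)
    (hpm : ¬ p ∣ m) (M : ℕ) :
    AddSubgroup.torsionBy (W.baseChange (ringClassField K ι m)).toAffine.Point ((p ^ M : ℕ) : ℤ) = ⊥ :=
  torsionBy_pow_eq_bot (p := p)
    (torsionBy_ringClassField_eq_bot_of_hasIrreducibleModPGaloisRep W hK ι hm hp hp2 hirr hW hKunr hpm) M

/-! ## §3 The `hA` binder on the irreducible cell -/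

section KolyvaginHeegnerData

open Literature.NumberTheory.EllipticCurves.ModularForms

variable {K : Type} [Field K] [NumberField K] {N : ℕ} [NeZero N] {W : WeierstrassCurve ℚ}
  {Dt : ModularParametrizationData W N} {β : ℤ} {ι : K →+* ℂ} {n : ℕ}
  (d : KolyvaginHeegnerData Dt β ι n)

/-- **The `hA` binder of the concrete `h44` chain ON THE IRREDUCIBLE CELL** — admissibility of
`E(K[n]) ⊆ E(K̄)` (printed `A = E(K_n)`: McCallum 1991 §4 (5); Gross 1991 Lemma 4.3 and (4.2)): for
`K` imaginary quadratic, a concrete Kolyvagin–Heegner datum `d` at level `n ≠ 0`, `p` odd with `E[p]`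
IRREDUCIBLE and the Weil pairing, `p` unramified in `K` and `p ∤ n`, and any `M`: `d.pointsSubgroup`
is `Γ_K`-stable (x11b3-p3's `RingClassNoTorsion.smul_toGeomPoints_eq`) and `p^M`-torsion-free
(`torsionBy_pow_ringClassField_eq_bot_of_hasIrreducibleModPGaloisRep`).  COMPLEMENT of
`RingClassNoTorsion.isAdmissible_pointsSubgroup` (from `Surj W p`); at `3 ∣ N` + Heegner the side
conditions hold on all of X11b@3.  HONEST: plumbing; `h44` / (γ) NOT discharged; nothing booked.
[cite: McCallumLMS1991, §4 (5)] [cite: GrossLMS1991, §4, Lemma 4.3 and (4.2)] -/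
theorem isAdmissible_pointsSubgroup_of_hasIrreducibleModPGaloisRep [W.IsElliptic]
    (hK : IsImaginaryQuadratic K) (hn : n ≠ 0) {p : ℕ} (hp : p.Prime) (hp2 : p ≠ 2)
    (hirr : W.HasIrreducibleModPGaloisRep p) (hW : W.exists_weilPairing p)
    (hKunr : ∀ v : HeightOneSpectrum (𝓞 ℚ), (p : 𝓞 ℚ) ∈ v.asIdeal →
      Algebra.IsUnramifiedIn (𝓞 K) v.asIdeal)
    (hpn : ¬ p ∣ n) (M : ℕ) :
    KolyvaginCocycle.IsAdmissible (absoluteGaloisGroup K) d.pointsSubgroup ((p ^ M : ℕ) : ℤ) where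
  smul_mem g := by
    rintro _ ⟨P, rfl⟩
    exact ⟨_, (RingClassNoTorsion.smul_toGeomPoints_eq d hK hn g P).symm⟩
  eq_zero_of_zsmul := by
    rintro _ ⟨P, rfl⟩ hP
    rw [← map_zsmul] at hP
    have hP0 : ((p ^ M : ℕ) : ℤ) • P = 0 :=
      (Affine.Point.map_injective (W' := W) d.emb.toRatAlgHom) (by rw [map_zero]; exact hP)
    have h : P ∈ AddSubgroup.torsionBy (W.baseChange (ringClassField K ι n)).toAffine.Point
        ((p ^ M : ℕ) : ℤ) := (Submodule.mem_torsionBy_iff ((p ^ M : ℕ) : ℤ) P).mpr hP0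
    rw [torsionBy_pow_ringClassField_eq_bot_of_hasIrreducibleModPGaloisRep W hK ι hn hp hp2 hirr hW
      hKunr hpn M, AddSubgroup.mem_bot] at h
    rw [h, map_zero]

/-- **Family form** — for `d m : KolyvaginHeegnerData Dt β ι m` at the divisors `m ∣ n` of one
top level `n` with `n ≠ 0`, `p ∤ n` (the currency `hA : ∀ m (hm : m ∣ n), …` of the concrete `h44`
chain), on the irreducible cell. [cite: McCallumLMS1991, §4 (5)] [cite: GrossLMS1991, §4, Lemma 4.3] -/
theorem isAdmissible_pointsSubgroup_of_hasIrreducibleModPGaloisRep_of_dvd [W.IsElliptic]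
    (hK : IsImaginaryQuadratic K) (hn : n ≠ 0) (d : ∀ m : ℕ, m ∣ n → KolyvaginHeegnerData Dt β ι m)
    {p : ℕ} (hp : p.Prime) (hp2 : p ≠ 2) (hirr : W.HasIrreducibleModPGaloisRep p)
    (hW : W.exists_weilPairing p)
    (hKunr : ∀ v : HeightOneSpectrum (𝓞 ℚ), (p : 𝓞 ℚ) ∈ v.asIdeal →
      Algebra.IsUnramifiedIn (𝓞 K) v.asIdeal)
    (hpn : ¬ p ∣ n) (M : ℕ) (m : ℕ) (hm : m ∣ n) :
    KolyvaginCocycle.IsAdmissible (absoluteGaloisGroup K) (d m hm).pointsSubgroup ((p ^ M : ℕ) : ℤ) :=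
  isAdmissible_pointsSubgroup_of_hasIrreducibleModPGaloisRep (d m hm) hK (ne_zero_of_dvd_ne_zero hn hm)
    hp hp2 hirr hW hKunr (fun h ↦ hpn (h.trans hm)) M

end KolyvaginHeegnerData

end Summit.BirchSwinnertonDyer.Rank1Residual.X11b.NoTorsionIrr

end
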